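import Literature.MathematicalPhysics.QuantumFieldTheory.Balaban1983to89.Setup
import HarnessLib

/-!
# S2β · D-GUARD ∕ (BG∞) — OFFSET COORDINATES OF A CLOSED BLOCK: a closed block `{x | ∀ κ, (x_κ − s_κ).val ≤ ℓ_κ}` of the torus IS the box of its offset vectors
# `t(x) := (κ ↦ (x_κ − s_κ).val)`, a bond inside it is a unit step of ONE offset, and any filling defined on offset vectors reads as a site function whose bond
# steps are the filling's unit steps ((G7)-lattice brick of UV3-NODE §116 ADD.1: the one lemma through which the index-free fillings ✓p839248 (I), ✓p839271 +
# px5 T2 ∕ px8 S2 (T∕S) become block sections; binder style, desk RULING №127)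

Cell `ym3-torus` (YM ladder rung R3 = continuum `SU(2)` Yang–Mills on the three-torus at fixed lattice data — a RUNG: NOT d = 4, NOT infinite volume,
NOT a mass gap, NOT Clay).  Width seat «width 19» `ym3-torus-px19` (gen 25, ★p1 lineage), FREE px helper on crux `stmt-QuantumFields-20520`
(`FluctuationComparisonRegPrIntL`; registry `Lines/semiclassical_s2beta.lean` UNTOUCHED, 0∕5); `--kind proof --supports stmt-QuantumFields-20520 --as helper`,
count-neutral, DEFINITION-FREE (0 `def`, 0 `instance`, 0 `notation`, 0 `sorry`, default heartbeats).

WHY.  The three filling stages of the (BG∞) gluing are typed INDEX-FREE (Stage I: ✓p839248 `fill φ₀ φ₁ m ℓ₁ ℓ₂ z k`; Stages T∕S: ✓p839271 cones read through px5's ∕ px8's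
radial projections on an abstract `n × n` square ∕ cube).  To make them sections on a closed block of the torus one reads a site `x` through its OFFSET VECTOR
`t(x) κ := (x_κ − s_κ).val ∈ [0, ℓ_κ]` and needs exactly: (O1) the site is its corner plus its offsets; (O2) along a bond `⟨x, μ⟩` inside the block the `μ`-offset
goes up by ONE and the others do not move (no wrap, since `ℓ_μ + 1 < N`); hence (O3) for ANY offset-indexed filling `F`, the site function `W x := F (t x)` steps
along the bond from `F t` to `F (update t μ (t μ + 1))` — so every abstract unit-step bound of `F` is a lattice bond bound of `W`, with no further bookkeeping.

WHAT IS PROVED (sorry-free; any `Params`, level `j`, `N := P.sitesPerDir j`; §3 for any codomain type).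
* §1 `natCast_val_sub_natCast` (`((x_κ − s).val : ZMod N) = x_κ − s`), ★ `eq_natCast_add_offset` (O1: `x κ = s_κ + (x_κ − s_κ).val` in `ZMod N`),
  `site_eq_of_offsets_eq` (two sites of the block with the same offsets are equal).
* §2 ★★ `offset_tgt_dir` (O2: `(b.tgt_μ − s_μ).val = (b.src_μ − s_μ).val + 1` for `μ = b.dir`, given the source offset `≤ ℓ_μ` and `ℓ_μ + 1 < N`), ★ `offset_tgt_ne`
  (`κ ≠ b.dir ⟹ (b.tgt_κ − s_κ).val = (b.src_κ − s_κ).val`), ★★ `offsets_tgt_eq_update` (the offset VECTOR of the target is `update (t src) b.dir (t src b.dir + 1)`).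
* §3 ★★★ `read_tgt_eq` (O3): for any `F : (Fin P.d → ℕ) → β`, `F (t b.tgt) = F (Function.update (t b.src) b.dir (t b.src b.dir + 1))` — the reading lemma.

HONEST SCOPE.  `ZMod.val` ∕ `Function.update` bookkeeping; nothing of Bałaban's renormalisation-group analysis is asserted or proved ([Balaban1985RegularSpaces] Lemma 1 p.79 —
cube-local gauges).  (BG∞) ∕ `hsupp⁺` is a CONJECTURE (plan §116) and is NOT proved; (L-I)(L-T)(L-S)(L-Σ) are OPEN; GAP♯∘ (`stub_uniformFibreGapOrbit`, registry UNTOUCHED), the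
five registered stubs (0∕5), S2β, 20520, 19936, 19200, `YM3TorusSU2` are NOT proved; no registered stub is closed; rung R3 — NOT d = 4, NOT infinite volume, NOT a mass gap,
NOT Clay; the Yang–Mills mass gap is NOT proved.  Axioms standard.

References: T. Bałaban, CMP **99** (1985) 75–102 [Balaban1985RegularSpaces] (Lemma 1 p.79, (1.29) p.81).
-/

set_option autoImplicit false

namespace Summit.QuantumFields.YangMills.Theorems.FluctuationComparisonRegPrIntLS2BetaBlockOffsetCoordinates

open Literature.MathematicalPhysics.QuantumFieldTheory.Balaban1983to89

variable {P : Params} {j : ℕ}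

/-! ## §1 A site is its corner plus its offsets -/

/-- `((v − s).val : ZMod N) = v − s`. [folklore] -/
theorem natCast_val_sub_natCast {N : ℕ} [NeZero N] (v : ZMod N) (s : ℕ) :
    (((v - (s : ZMod N)).val : ℕ) : ZMod N) = v - (s : ZMod N) :=
  ZMod.natCast_zmod_val _

/-- ★ **(O1)** `x κ = s_κ + (x_κ − s_κ).val` in `ZMod N`: a site of the block is its corner plus its offset vector. [folklore] -/
theorem eq_natCast_add_offset (s : Fin P.d → ℕ) (x : Site P j) (κ : Fin P.d) :
    x κ = ((s κ : ℕ) : ZMod (P.sitesPerDir j)) + (((x κ - ((s κ : ℕ) : ZMod (P.sitesPerDir j))).val : ℕ) : ZMod (P.sitesPerDir j)) := by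
  rw [natCast_val_sub_natCast, add_sub_cancel]

/-- Two sites with the same offset vector (w.r.t. the same corner) are equal. [folklore] -/
theorem site_eq_of_offsets_eq (s : Fin P.d → ℕ) (x y : Site P j)
    (h : ∀ κ, (x κ - ((s κ : ℕ) : ZMod (P.sitesPerDir j))).val = (y κ - ((s κ : ℕ) : ZMod (P.sitesPerDir j))).val) : x = y := by
  funext κ
  rw [eq_natCast_add_offset s x κ, eq_natCast_add_offset s y κ, h κ]

/-! ## §2 A bond inside the block is a unit step of one offset -/

/-- ★★ **(O2) THE STEP OFFSET**: along the bond `b` (direction `μ := b.dir`), if the source's `μ`-offset `t` satisfies `t + 1 < N`, the target's `μ`-offset is `t + 1`.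
[folklore] -/
theorem offset_tgt_dir (s : Fin P.d → ℕ) (b : PBond P j) {t : ℕ}
    (ht : (b.src b.dir - ((s b.dir : ℕ) : ZMod (P.sitesPerDir j))).val = t) (hN : t + 1 < P.sitesPerDir j) :
    (b.tgt b.dir - ((s b.dir : ℕ) : ZMod (P.sitesPerDir j))).val = t + 1 := by
  have h1 : b.tgt b.dir = b.src b.dir + 1 := by
    show Function.update b.src b.dir (b.src b.dir + 1) b.dir = _
    rw [Function.update_self]
  rw [h1, show b.src b.dir + 1 - ((s b.dir : ℕ) : ZMod (P.sitesPerDir j)) =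
      (b.src b.dir - ((s b.dir : ℕ) : ZMod (P.sitesPerDir j))) + ((1 : ℕ) : ZMod (P.sitesPerDir j)) by push_cast; ring,
    ZMod.val_add_of_lt (by rw [ht, ZMod.val_natCast_of_lt (by omega)]; exact hN), ht, ZMod.val_natCast_of_lt (by omega)]

/-- ★ **THE OTHER OFFSETS DO NOT MOVE**: for `κ ≠ b.dir`, `b.tgt κ = b.src κ`, hence equal offsets. [folklore] -/
theorem offset_tgt_ne (s : Fin P.d → ℕ) (b : PBond P j) {κ : Fin P.d} (hκ : κ ≠ b.dir) :
    (b.tgt κ - ((s κ : ℕ) : ZMod (P.sitesPerDir j))).val = (b.src κ - ((s κ : ℕ) : ZMod (P.sitesPerDir j))).val := by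
  have h1 : b.tgt κ = b.src κ := by
    show Function.update b.src b.dir (b.src b.dir + 1) κ = _
    rw [Function.update_of_ne hκ]
  rw [h1]

/-- ★★ **THE OFFSET VECTOR OF THE TARGET** is the source's, updated by `+1` in the bond's direction (given no wrap in that direction). [folklore] -/
theorem offsets_tgt_eq_update (s : Fin P.d → ℕ) (b : PBond P j)
    (hN : (b.src b.dir - ((s b.dir : ℕ) : ZMod (P.sitesPerDir j))).val + 1 < P.sitesPerDir j) :
    (fun κ => (b.tgt κ - ((s κ : ℕ) : ZMod (P.sitesPerDir j))).val) =
      Function.update (fun κ => (b.src κ - ((s κ : ℕ) : ZMod (P.sitesPerDir j))).val) b.dir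
        ((b.src b.dir - ((s b.dir : ℕ) : ZMod (P.sitesPerDir j))).val + 1) := by
  funext κ
  by_cases hκ : κ = b.dir
  · subst hκ
    rw [Function.update_self]
    exact offset_tgt_dir s b rfl hN
  · rw [Function.update_of_ne hκ]
    exact offset_tgt_ne s b hκ

/-! ## §3 The reading lemma -/

/-- ★★★ **(O3) READING AN OFFSET-INDEXED FILLING THROUGH THE BLOCK**: for ANY `F : (Fin P.d → ℕ) → β` and the site function `W x := F (offsets of x)`, along a bond
`b` with no wrap in its direction, `W (b.tgt) = F (update (offsets of b.src) b.dir (offset + 1))` — every abstract unit-step bound of `F` is a lattice bond bound.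
[cite: Balaban1985RegularSpaces, Lemma 1 p.79] -/
theorem read_tgt_eq {β : Type*} (F : (Fin P.d → ℕ) → β) (s : Fin P.d → ℕ) (b : PBond P j)
    (hN : (b.src b.dir - ((s b.dir : ℕ) : ZMod (P.sitesPerDir j))).val + 1 < P.sitesPerDir j) :
    F (fun κ => (b.tgt κ - ((s κ : ℕ) : ZMod (P.sitesPerDir j))).val) =
      F (Function.update (fun κ => (b.src κ - ((s κ : ℕ) : ZMod (P.sitesPerDir j))).val) b.dir
        ((b.src b.dir - ((s b.dir : ℕ) : ZMod (P.sitesPerDir j))).val + 1)) := by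
  rw [offsets_tgt_eq_update s b hN]

/-- The no-wrap side condition from the block: source offset `≤ ℓ_μ` and `ℓ_μ + 1 < N`. [folklore] -/
theorem offset_succ_lt_of_le (s ℓ : Fin P.d → ℕ) (hℓ : ∀ κ, ℓ κ + 1 < P.sitesPerDir j) (b : PBond P j)
    (hsrc : ∀ κ, (b.src κ - ((s κ : ℕ) : ZMod (P.sitesPerDir j))).val ≤ ℓ κ) :
    (b.src b.dir - ((s b.dir : ℕ) : ZMod (P.sitesPerDir j))).val + 1 < P.sitesPerDir j :=
  lt_of_le_of_lt (Nat.add_le_add_right (hsrc b.dir) 1) (hℓ b.dir)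

end Summit.QuantumFields.YangMills.Theorems.FluctuationComparisonRegPrIntLS2BetaBlockOffsetCoordinates
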